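import Literature.AnabelianGeometry.AbsoluteAnabelian.LocalUnramifiedQuotientH2
import Literature.NumberTheory.GaloisRepresentations.ContinuousCohomologyBocksteinFunctorial
import Literature.NumberTheory.GaloisRepresentations.LocalGaloisGroupInertiaProofs
import Literature.NumberTheory.GaloisRepresentations.LocalGaloisGroupProofs
import HarnessLib

/-!
# The index formula for `H²(Gal(F^nr/F), ℤ) ⥲ ℚ/ℤ` under a finite extension `E/F`:
# `inv_E ∘ res = f · inv_F` on the unramified quotients

abc-iut cell, layer L4.  `E/F` an extension of non-archimedean local fields (an `F`-algebra
structure on `E`; the compatibility of the valuations is automatic, tree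
`valuativeExtension_of_residueFieldCard_eq_pow`), `f` with `q_E = q_F ^ f` (the residue degree).  The restriction `res : Γ_E → Γ_F` (`absGaloisRestrict F E`) maps inertia into
inertia and sends an arithmetic Frobenius of `E` to a Frobenius power of exponent `f` for `F`
(tree: `absInertia_map_absGaloisRestrict_le_holds`, `IsFrobPow.absGaloisRestrict_holds`,
Serre *Local Fields* I §7–8), hence induces

* `unrQuotientMap F E : Gal(E^nr/E) → Gal(F^nr/F)` (`= Γ_E ⧸ galUnr E → Γ_F ⧸ galUnr F`), a
  continuous homomorphism with `unrQuotientMap_mk_eq_pow : Frob̄_E ↦ Frob̄_F ^ f`;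

and the trunk's index formula (`ContinuousCohomologyBocksteinFunctorial.H2IntEquivQModZ_pullH`)
gives

* **`H2UnrEquivQModZ_pullH_unrQuotientMap` — `inv_E(res c) = f • inv_F(c)`** for every
  `c ∈ H²(Gal(F^nr/F), ℤ)`, with `inv_F = H2UnrEquivQModZ` of `LocalUnramifiedQuotientH2.lean`
  (`[c] ↦ (δ⁻¹[c])(Frob̄)`) and `res = pullH (unrQuotientMap F E)`;
* `unrQuotientMapOfEquiv`, **`H2UnrEquivQModZ_pullH_unrQuotientMapOfEquiv`** — TRANSPORT: an
  isomorphism `α : Γ_{K₁} ≃ Γ_{K₂}` carrying inertia into inertia and a Frobenius to a Frobenius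
  ([AbsAnab] Prop. 1.2.1 (ii), (iv)) identifies the invariants, `inv₁(α^* c) = inv₂(c)` — the
  unramified-quotient layer of [AbsAnab] Prop. 1.2.1 (vii) «α preserves the residue map» (the
  proof's last arrow `H²(Ẑ, ℤ) = ℚ/ℤ`, «group-theoretic by (ii), (iii), (iv)»; sub-DAG rows
  L05′/L09/L00 of plan/L4/SUBDAG-AbsAnab-Prop121vii.md consume it together with the Brauer arrows).

This is the group-cohomological half of the classical `inv_E ∘ res_{E/F} = [E : F] · inv_F`
(Serre, *Local Fields*, XIII §3 Prop. 7; Cassels–Fröhlich VI §1.1) — the other half, the factor `e`,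
comes from the valuation normalisation `v_E|_{F^unr} = e · v_F` on `(F^unr)^×`, which is not here —
and the kernel content of [AbsTopIII] Rmk. 1.10.1 (iii) / Rmk. 3.2.2 «the functoriality … is to be
understood in the sense of a compatibility relative to dividing the `Ẑ` … by a factor given by the
index of the image of the induced open homomorphism on arithmetic Galois groups» restricted to the
unramified quotients (sub-DAG rows P32.i.L07 `Prop32i_indexCompat`, AbsAnab:Prop1.2.1(vii)/L00's
transport pattern).  HONEST FRAMING: textbook material; proofs over the tree's real objects; nothing
here bears on [IUTchIII] Cor. 3.12 or takes a side.
-/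

noncomputable section

open CategoryTheory Function
open Field IsNonarchimedeanLocalField ValuativeRel

universe u

namespace Literature.AnabelianGeometry.AbsoluteAnabelian

open Literature.NumberTheory.GaloisRepresentations
open Literature.NumberTheory.GaloisRepresentations.IsNonarchimedeanLocalField
open _root_.TopRep _root_.ContRepresentation _root_.ContinuousCohomology _root_.Topology

variable (F E : Type u) [Field F] [ValuativeRel F] [TopologicalSpace F] [IsNonarchimedeanLocalField F]
  [Field E] [ValuativeRel E] [TopologicalSpace E] [IsNonarchimedeanLocalField E] [Algebra F E]

/-- The restriction `Γ_E → Γ_F` maps `Gal(Ē/E^nr)` into `Gal(F̄/F^nr)` (inertia into inertia).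
[cite: SerreLocalFields1979, Ch. I §7 Prop. 22 a)] -/
theorem galUnr_le_comap_absGaloisRestrict :
    galUnr E ≤ (galUnr F).comap (absGaloisRestrict F E).toMonoidHom := fun σ hσ => by
  rw [Subgroup.mem_comap]
  exact absInertia_le_galUnr F (absInertia_map_absGaloisRestrict_le_holds F E
    (Subgroup.mem_map_of_mem _ (galUnr_le_absInertia E hσ)))

/-- **`Gal(E^nr/E) → Gal(F^nr/F)`**, the continuous homomorphism of the unramified quotients
induced by the restriction `Γ_E → Γ_F`. [cite: SerreLocalFields1979, Ch. I §7 Prop. 22 a)] -/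
def unrQuotientMap : (absoluteGaloisGroup E ⧸ galUnr E) →ₜ* (absoluteGaloisGroup F ⧸ galUnr F) where
  toMonoidHom := QuotientGroup.map (galUnr E) (galUnr F) (absGaloisRestrict F E).toMonoidHom
    (galUnr_le_comap_absGaloisRestrict F E)
  continuous_toFun := by
    rw [(QuotientGroup.isQuotientMap_mk (galUnr E)).continuous_iff]
    exact (QuotientGroup.continuous_mk.comp (absGaloisRestrict F E).continuous).congr fun _ => rfl

/-- `unrQuotientMap F E (σ̄) = res(σ)̄`. [cite: SerreLocalFields1979, Ch. I §7 Prop. 22 a)] -/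
@[simp] theorem unrQuotientMap_mk (σ : absoluteGaloisGroup E) :
    unrQuotientMap F E (QuotientGroup.mk σ) = QuotientGroup.mk (absGaloisRestrict F E σ) :=
  rfl

variable {F E} in
/-- **`Frob̄_E ↦ Frob̄_F ^ f`**: the image of the Frobenius of `E` in `Gal(F^nr/F)` is the `f`-th power
of the Frobenius of `F`, `f` the residue degree (`q_E = q_F ^ f`).
[cite: SerreLocalFields1979, Ch. I §8] -/
theorem unrQuotientMap_mk_eq_pow {φE : absoluteGaloisGroup E} {φF : absoluteGaloisGroup F}
    (hφE : IsFrobPow φE 1) (hφF : IsFrobPow φF 1) {f : ℕ}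
    (hf : residueFieldCard E = residueFieldCard F ^ f) :
    unrQuotientMap F E (QuotientGroup.mk φE) = (QuotientGroup.mk φF) ^ f := by
  rw [unrQuotientMap_mk]
  have h := IsFrobPow.absGaloisRestrict_holds F hφE f hf
  rw [mul_one] at h
  exact mk_eq_mk_pow_of_isFrobPow hφF h

variable {F E} in
/-- **The index formula `inv_E(res c) = f • inv_F(c)`** on the unramified quotients: for every class
`c ∈ H²(Gal(F^nr/F), ℤ)`, the invariant (`H2UnrEquivQModZ`, through the Frobenius of `E`) of its
pull-back to `Gal(E^nr/E)` is `f` times its invariant (through the Frobenius of `F`), `f` the residue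
degree of `E/F`. [cite: SerreLocalFields1979, XIII §3 Prop. 7] -/
theorem H2UnrEquivQModZ_pullH_unrQuotientMap {φE : absoluteGaloisGroup E}
    {φF : absoluteGaloisGroup F} (hφE : IsFrobPow φE 1) (hφF : IsFrobPow φF 1) {f : ℕ}
    (hf : residueFieldCard E = residueFieldCard F ^ f)
    (c : continuousCohomology 2
      (ContinuousRep.trivial (absoluteGaloisGroup F ⧸ galUnr F) ℤ ZCoeff.{u}).toTopRep) :
    H2UnrEquivQModZ hφE
        (pullH (unrQuotientMap F E)
          (ContinuousRep.trivial (absoluteGaloisGroup F ⧸ galUnr F) ℤ ZCoeff.{u}) 2 c) =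
      f • H2UnrEquivQModZ hφF c :=
  H2IntEquivQModZ_pullH_of_pow_eq (unrQuotientMap F E) (unrQuotientMap_mk_eq_pow hφE hφF hf)
    (dense_zpowers_mk_of_isFrobPow hφF) (exists_isOpen_index_quotient_galUnr F)
    (dense_zpowers_mk_of_isFrobPow hφE) (exists_isOpen_index_quotient_galUnr E) c

/-! ### Transport along an isomorphism of absolute Galois groups preserving inertia and Frobenius -/

section Transport

variable {K₁ K₂ : Type u} [Field K₁] [ValuativeRel K₁] [TopologicalSpace K₁]
  [IsNonarchimedeanLocalField K₁] [Field K₂] [ValuativeRel K₂] [TopologicalSpace K₂]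
  [IsNonarchimedeanLocalField K₂]

/-- **The isomorphism `Gal(K₁^nr/K₁) → Gal(K₂^nr/K₂)` induced by an isomorphism of absolute Galois
groups `α : Γ_{K₁} ≃ Γ_{K₂}` carrying inertia into inertia** ([AbsAnab] Prop. 1.2.1 (ii): `α(I_{K₁}) =
I_{K₂}`), as a continuous homomorphism of the unramified quotients.
[cite: MochizukiAbsAnab2004, Prop 1.2.1 (ii) p.10] -/
def unrQuotientMapOfEquiv (α : absoluteGaloisGroup K₁ ≃ₜ* absoluteGaloisGroup K₂)
    (hI : ∀ σ ∈ galUnr K₁, α σ ∈ galUnr K₂) :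
    (absoluteGaloisGroup K₁ ⧸ galUnr K₁) →ₜ* (absoluteGaloisGroup K₂ ⧸ galUnr K₂) where
  toMonoidHom := QuotientGroup.map (galUnr K₁) (galUnr K₂) α.toMonoidHom
    (fun σ hσ => by rw [Subgroup.mem_comap]; exact hI σ hσ)
  continuous_toFun := by
    rw [(QuotientGroup.isQuotientMap_mk (galUnr K₁)).continuous_iff]
    exact (QuotientGroup.continuous_mk.comp α.continuous).congr fun _ => rfl

/-- `unrQuotientMapOfEquiv α hI (σ̄) = α(σ)̄`. [cite: MochizukiAbsAnab2004, Prop 1.2.1 (ii) p.10] -/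
@[simp] theorem unrQuotientMapOfEquiv_mk (α : absoluteGaloisGroup K₁ ≃ₜ* absoluteGaloisGroup K₂)
    (hI : ∀ σ ∈ galUnr K₁, α σ ∈ galUnr K₂) (σ : absoluteGaloisGroup K₁) :
    unrQuotientMapOfEquiv α hI (QuotientGroup.mk σ) = QuotientGroup.mk (α σ) :=
  rfl

/-- **[AbsAnab] Prop. 1.2.1 (vii) on the unramified quotients**: if `α : Γ_{K₁} ≃ Γ_{K₂}` carries
inertia into inertia ((ii)) and SOME arithmetic Frobenius of `K₁` to an arithmetic Frobenius of `K₂`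
((iv): «α preserves the Frobenius element»), then the induced map `Gal(K₁^nr/K₁) → Gal(K₂^nr/K₂)`
identifies the invariants `H²(Gal(Kᵢ^nr/Kᵢ), ℤ) ⥲ ℚ/ℤ`: `inv₁(α^* c) = inv₂(c)` for every
`c ∈ H²(Gal(K₂^nr/K₂), ℤ)` and ANY Frobenius lifts `φ₁`, `φ₂` used to normalise `inv₁`, `inv₂` — the
«group-theoreticity» of the last arrow `H²(Ẑ, ℤ) = ℚ/ℤ` of the residue map (proof of (vii), p. 11–12,
«by (ii), (iii), (iv)»). [cite: MochizukiAbsAnab2004, Prop 1.2.1 (vii) p.11] -/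
theorem H2UnrEquivQModZ_pullH_unrQuotientMapOfEquiv
    (α : absoluteGaloisGroup K₁ ≃ₜ* absoluteGaloisGroup K₂)
    (hI : ∀ σ ∈ galUnr K₁, α σ ∈ galUnr K₂)
    {φ₁ : absoluteGaloisGroup K₁} {φ₂ : absoluteGaloisGroup K₂} (hφ₁ : IsFrobPow φ₁ 1)
    (hφ₂ : IsFrobPow φ₂ 1)
    (hF : ∃ ψ : absoluteGaloisGroup K₁, IsFrobPow ψ 1 ∧ IsFrobPow (α ψ) 1)
    (c : continuousCohomology 2
      (ContinuousRep.trivial (absoluteGaloisGroup K₂ ⧸ galUnr K₂) ℤ ZCoeff.{u}).toTopRep) :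
    H2UnrEquivQModZ hφ₁
        (pullH (unrQuotientMapOfEquiv α hI)
          (ContinuousRep.trivial (absoluteGaloisGroup K₂ ⧸ galUnr K₂) ℤ ZCoeff.{u}) 2 c) =
      H2UnrEquivQModZ hφ₂ c := by
  obtain ⟨ψ, hψ, hαψ⟩ := hF
  -- normalise both sides by the matching pair `(ψ, α ψ)`
  rw [H2UnrEquivQModZ_eq hφ₁ hψ, H2UnrEquivQModZ_eq hφ₂ hαψ]
  exact H2IntEquivQModZ_pullH_of_eq (unrQuotientMapOfEquiv α hI)
    (unrQuotientMapOfEquiv_mk α hI ψ) (dense_zpowers_mk_of_isFrobPow hαψ)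
    (exists_isOpen_index_quotient_galUnr K₂) (dense_zpowers_mk_of_isFrobPow hψ)
    (exists_isOpen_index_quotient_galUnr K₁) c

end Transport

end Literature.AnabelianGeometry.AbsoluteAnabelian

end
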